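import Summits.RiemannHypothesis.RiemannHypothesis.Theorems.WeilFormatCDataO109FrontDataW
import Summits.RiemannHypothesis.RiemannHypothesis.Theorems.WeilFormatCDataA1RungCB
import Summits.RiemannHypothesis.RiemannHypothesis.Theorems.S2FormatCE0
import Literature.NumberTheory.LFunctions.YoshidaWindowGramTailMSSines
import Literature.NumberTheory.LFunctions.YoshidaWindowGramMiddleJBox
import Literature.NumberTheory.LFunctions.YoshidaWindowGramTailJFactoredScaled
import Literature.NumberTheory.LFunctions.YoshidaWindowGramTailMSFactored
import Literature.NumberTheory.LFunctions.YoshidaWindowGramTailJDiagTight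
import Summits.RiemannHypothesis.RiemannHypothesis.Theorems.FormatCPsdBands
import Summits.RiemannHypothesis.RiemannHypothesis.Theorems.WeilFormatCDiagShift
import Summits.RiemannHypothesis.RiemannHypothesis.Theorems.FormatCPsdSymmBands
import HarnessLib
import Summits.RiemannHypothesis.RiemannHypothesis.Theorems.WeilFormatCDataO109TabValid15
import Summits.RiemannHypothesis.RiemannHypothesis.Theorems.WeilFormatCDataO109TabValid16
import Summits.RiemannHypothesis.RiemannHypothesis.Theorems.WeilFormatCDataO109TabValid17
import Summits.RiemannHypothesis.RiemannHypothesis.Theorems.WeilFormatCDataO109TabValid18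
import Summits.RiemannHypothesis.RiemannHypothesis.Theorems.WeilFormatCDataO109TabValid19
import Summits.RiemannHypothesis.RiemannHypothesis.Theorems.WeilFormatCDataO109TabValid20
import Summits.RiemannHypothesis.RiemannHypothesis.Theorems.WeilFormatCDataO109TabValid21
import Summits.RiemannHypothesis.RiemannHypothesis.Theorems.WeilFormatCDataO109TabValid
import Summits.RiemannHypothesis.RiemannHypothesis.Theorems.WeilFormatCDataO109OddAsmB
import Summits.RiemannHypothesis.RiemannHypothesis.Theorems.WeilFormatCDataO109OddAsmA

/-!
# Format C kernel rung `O109` (a = 109/100, column-band layout): ASSEMBLY of the flat layout, part C of 11 (ladders of TabValid1 (cont.); split of the 2865-line assembly at block boundaries by prover B g19 for the 400-line cap; blocks byte-identical): every propositional ladder of the kernel files (table/column validity, front door, sines, middle moments, column data, tail factors, Schur rows, (P) + diagonal shift), byte-identical statements and proofs, original order (A g22 restage_flat.py; weil-2 KERNEL-CHAIN-RULES #1)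

Window `a = 109/100`; prime powers in the window: 2, 3, 2^2, 5, 7, 2^3; prime constant A = 2358/1000 (`WeilFormatC.primeCoeff_form_ge_cells_1098`); evaluator parameters S = 2^320, Kpi 160, Kser 190, kred 8, Kexp 55, J 150; full table modes < 321; light column table modes < 2051; units 2^-310 (Schur entries), 2^-154 (column digits, width 157), 2^-148 (tail-factor digits, width 151), 2^-64 (reciprocal weights), 2^-40 (tail base); order-J tail J = 4, θ = 1/2048, η = 1/10 | 4/1.
Design row: sr-gb-rung-b B g22 hp odd λ-run = PARITY CELL 17 L-SIDE: a = 109/100 with SIX prime powers 2,3,4,5,7,8 (kmax 8; WeilFormatC.primeCoeff_form_ge_cells_1098, A = 2358/1000; 0.0086 below the (log 9)/2 resonance — the last full cell of this kit), μ = 2^-113 = 9.6e-35, odd 320/640/2048, kit precision S 2^320 / c 310 / Kpi 160 / Kser 190 / Kexp 55 / J 150 (A g23 hp levers), MS tail; probes (B g22): λ_min(DS) 8.15e-35 @ 109/100, 3.75e-34 @ 217/200 (Bo 320); see HOME(B)/CELL16-LSIDE-B-g22.md. Generated by sr-gb-rung-a prover A g22 with rh-explicit-weil-2 gen7's generator extended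 for the odd λ-run (--sector odd --mu-log2; HOME(A)/code-g22/gen7/gramgen7.py sha16 b22c17hp00000109) from `#eval` of the tree's `Encl` functions; every datum is re-verified by the kernel in the theorem files (`decide +kernel`). Helper data of the rh-explicit Weil-positivity programme (format C, K-CELL-2), RH-free. [cite: Yoshida1992HermitianForms, §5 (5.15)-(5.16) p. 301; §7 pp. 305–312]
-/

set_option linter.dupNamespace false
set_option exponentiation.threshold 1024
set_option maxRecDepth 200000

-- ===== from WeilFormatCDataO109TabValid1 (continued) =====
namespace Summit.RiemannHypothesis.RiemannHypothesis.Theorems.WeilFormatCData.O109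
open Literature.NumberTheory.LFunctions Literature.NumberTheory.LFunctions.Yoshida1992 Encl Literature.Analysis.ValidatedNumerics.NumericsMP

/-- the special-value table is valid below `220` (partial). -/
theorem tabv220 : TabValid (2 ^ 320) O109.a O109.ks 220 O109.tab := by
  have h205 : TabValid (2 ^ 320) a ks 205 tab := tabv205
  have h206 : TabValid (2 ^ 320) a ks (205 + 1) tab :=
    h205.extend fun n hn hnk ↦ idxValid_of_checkTable (prm := prm) (by norm_num [prm]) a_pos consts_valid tT205 hn hnk
  have h207 : TabValid (2 ^ 320) a ks (206 + 1) tab :=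
    h206.extend fun n hn hnk ↦ idxValid_of_checkTable (prm := prm) (by norm_num [prm]) a_pos consts_valid tT206 hn hnk
  have h208 : TabValid (2 ^ 320) a ks (207 + 1) tab :=
    h207.extend fun n hn hnk ↦ idxValid_of_checkTable (prm := prm) (by norm_num [prm]) a_pos consts_valid tT207 hn hnk
  have h209 : TabValid (2 ^ 320) a ks (208 + 1) tab :=
    h208.extend fun n hn hnk ↦ idxValid_of_checkTable (prm := prm) (by norm_num [prm]) a_pos consts_valid tT208 hn hnk
  have h210 : TabValid (2 ^ 320) a ks (209 + 1) tab :=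
    h209.extend fun n hn hnk ↦ idxValid_of_checkTable (prm := prm) (by norm_num [prm]) a_pos consts_valid tT209 hn hnk
  have h211 : TabValid (2 ^ 320) a ks (210 + 1) tab :=
    h210.extend fun n hn hnk ↦ idxValid_of_checkTable (prm := prm) (by norm_num [prm]) a_pos consts_valid tT210 hn hnk
  have h212 : TabValid (2 ^ 320) a ks (211 + 1) tab :=
    h211.extend fun n hn hnk ↦ idxValid_of_checkTable (prm := prm) (by norm_num [prm]) a_pos consts_valid tT211 hn hnk
  have h213 : TabValid (2 ^ 320) a ks (212 + 1) tab :=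
    h212.extend fun n hn hnk ↦ idxValid_of_checkTable (prm := prm) (by norm_num [prm]) a_pos consts_valid tT212 hn hnk
  have h214 : TabValid (2 ^ 320) a ks (213 + 1) tab :=
    h213.extend fun n hn hnk ↦ idxValid_of_checkTable (prm := prm) (by norm_num [prm]) a_pos consts_valid tT213 hn hnk
  have h215 : TabValid (2 ^ 320) a ks (214 + 1) tab :=
    h214.extend fun n hn hnk ↦ idxValid_of_checkTable (prm := prm) (by norm_num [prm]) a_pos consts_valid tT214 hn hnk
  have h216 : TabValid (2 ^ 320) a ks (215 + 1) tab :=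
    h215.extend fun n hn hnk ↦ idxValid_of_checkTable (prm := prm) (by norm_num [prm]) a_pos consts_valid tT215 hn hnk
  have h217 : TabValid (2 ^ 320) a ks (216 + 1) tab :=
    h216.extend fun n hn hnk ↦ idxValid_of_checkTable (prm := prm) (by norm_num [prm]) a_pos consts_valid tT216 hn hnk
  have h218 : TabValid (2 ^ 320) a ks (217 + 1) tab :=
    h217.extend fun n hn hnk ↦ idxValid_of_checkTable (prm := prm) (by norm_num [prm]) a_pos consts_valid tT217 hn hnk
  have h219 : TabValid (2 ^ 320) a ks (218 + 1) tab :=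
    h218.extend fun n hn hnk ↦ idxValid_of_checkTable (prm := prm) (by norm_num [prm]) a_pos consts_valid tT218 hn hnk
  have h220 : TabValid (2 ^ 320) a ks (219 + 1) tab :=
    h219.extend fun n hn hnk ↦ idxValid_of_checkTable (prm := prm) (by norm_num [prm]) a_pos consts_valid tT219 hn hnk
  exact h220

-- (merged) from WeilFormatCDataO109TabValid16

/-- the special-value table is valid below `235` (partial). -/
theorem tabv235 : TabValid (2 ^ 320) O109.a O109.ks 235 O109.tab := by
  have h220 : TabValid (2 ^ 320) a ks 220 tab := tabv220
  have h221 : TabValid (2 ^ 320) a ks (220 + 1) tab :=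
    h220.extend fun n hn hnk ↦ idxValid_of_checkTable (prm := prm) (by norm_num [prm]) a_pos consts_valid tT220 hn hnk
  have h222 : TabValid (2 ^ 320) a ks (221 + 1) tab :=
    h221.extend fun n hn hnk ↦ idxValid_of_checkTable (prm := prm) (by norm_num [prm]) a_pos consts_valid tT221 hn hnk
  have h223 : TabValid (2 ^ 320) a ks (222 + 1) tab :=
    h222.extend fun n hn hnk ↦ idxValid_of_checkTable (prm := prm) (by norm_num [prm]) a_pos consts_valid tT222 hn hnk
  have h224 : TabValid (2 ^ 320) a ks (223 + 1) tab :=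
    h223.extend fun n hn hnk ↦ idxValid_of_checkTable (prm := prm) (by norm_num [prm]) a_pos consts_valid tT223 hn hnk
  have h225 : TabValid (2 ^ 320) a ks (224 + 1) tab :=
    h224.extend fun n hn hnk ↦ idxValid_of_checkTable (prm := prm) (by norm_num [prm]) a_pos consts_valid tT224 hn hnk
  have h226 : TabValid (2 ^ 320) a ks (225 + 1) tab :=
    h225.extend fun n hn hnk ↦ idxValid_of_checkTable (prm := prm) (by norm_num [prm]) a_pos consts_valid tT225 hn hnk
  have h227 : TabValid (2 ^ 320) a ks (226 + 1) tab :=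
    h226.extend fun n hn hnk ↦ idxValid_of_checkTable (prm := prm) (by norm_num [prm]) a_pos consts_valid tT226 hn hnk
  have h228 : TabValid (2 ^ 320) a ks (227 + 1) tab :=
    h227.extend fun n hn hnk ↦ idxValid_of_checkTable (prm := prm) (by norm_num [prm]) a_pos consts_valid tT227 hn hnk
  have h229 : TabValid (2 ^ 320) a ks (228 + 1) tab :=
    h228.extend fun n hn hnk ↦ idxValid_of_checkTable (prm := prm) (by norm_num [prm]) a_pos consts_valid tT228 hn hnk
  have h230 : TabValid (2 ^ 320) a ks (229 + 1) tab :=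
    h229.extend fun n hn hnk ↦ idxValid_of_checkTable (prm := prm) (by norm_num [prm]) a_pos consts_valid tT229 hn hnk
  have h231 : TabValid (2 ^ 320) a ks (230 + 1) tab :=
    h230.extend fun n hn hnk ↦ idxValid_of_checkTable (prm := prm) (by norm_num [prm]) a_pos consts_valid tT230 hn hnk
  have h232 : TabValid (2 ^ 320) a ks (231 + 1) tab :=
    h231.extend fun n hn hnk ↦ idxValid_of_checkTable (prm := prm) (by norm_num [prm]) a_pos consts_valid tT231 hn hnk
  have h233 : TabValid (2 ^ 320) a ks (232 + 1) tab :=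
    h232.extend fun n hn hnk ↦ idxValid_of_checkTable (prm := prm) (by norm_num [prm]) a_pos consts_valid tT232 hn hnk
  have h234 : TabValid (2 ^ 320) a ks (233 + 1) tab :=
    h233.extend fun n hn hnk ↦ idxValid_of_checkTable (prm := prm) (by norm_num [prm]) a_pos consts_valid tT233 hn hnk
  have h235 : TabValid (2 ^ 320) a ks (234 + 1) tab :=
    h234.extend fun n hn hnk ↦ idxValid_of_checkTable (prm := prm) (by norm_num [prm]) a_pos consts_valid tT234 hn hnk
  exact h235

-- (merged) from WeilFormatCDataO109TabValid17

/-- the special-value table is valid below `250` (partial). -/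
theorem tabv250 : TabValid (2 ^ 320) O109.a O109.ks 250 O109.tab := by
  have h235 : TabValid (2 ^ 320) a ks 235 tab := tabv235
  have h236 : TabValid (2 ^ 320) a ks (235 + 1) tab :=
    h235.extend fun n hn hnk ↦ idxValid_of_checkTable (prm := prm) (by norm_num [prm]) a_pos consts_valid tT235 hn hnk
  have h237 : TabValid (2 ^ 320) a ks (236 + 1) tab :=
    h236.extend fun n hn hnk ↦ idxValid_of_checkTable (prm := prm) (by norm_num [prm]) a_pos consts_valid tT236 hn hnk
  have h238 : TabValid (2 ^ 320) a ks (237 + 1) tab :=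
    h237.extend fun n hn hnk ↦ idxValid_of_checkTable (prm := prm) (by norm_num [prm]) a_pos consts_valid tT237 hn hnk
  have h239 : TabValid (2 ^ 320) a ks (238 + 1) tab :=
    h238.extend fun n hn hnk ↦ idxValid_of_checkTable (prm := prm) (by norm_num [prm]) a_pos consts_valid tT238 hn hnk
  have h240 : TabValid (2 ^ 320) a ks (239 + 1) tab :=
    h239.extend fun n hn hnk ↦ idxValid_of_checkTable (prm := prm) (by norm_num [prm]) a_pos consts_valid tT239 hn hnk
  have h241 : TabValid (2 ^ 320) a ks (240 + 1) tab :=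
    h240.extend fun n hn hnk ↦ idxValid_of_checkTable (prm := prm) (by norm_num [prm]) a_pos consts_valid tT240 hn hnk
  have h242 : TabValid (2 ^ 320) a ks (241 + 1) tab :=
    h241.extend fun n hn hnk ↦ idxValid_of_checkTable (prm := prm) (by norm_num [prm]) a_pos consts_valid tT241 hn hnk
  have h243 : TabValid (2 ^ 320) a ks (242 + 1) tab :=
    h242.extend fun n hn hnk ↦ idxValid_of_checkTable (prm := prm) (by norm_num [prm]) a_pos consts_valid tT242 hn hnk
  have h244 : TabValid (2 ^ 320) a ks (243 + 1) tab :=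
    h243.extend fun n hn hnk ↦ idxValid_of_checkTable (prm := prm) (by norm_num [prm]) a_pos consts_valid tT243 hn hnk
  have h245 : TabValid (2 ^ 320) a ks (244 + 1) tab :=
    h244.extend fun n hn hnk ↦ idxValid_of_checkTable (prm := prm) (by norm_num [prm]) a_pos consts_valid tT244 hn hnk
  have h246 : TabValid (2 ^ 320) a ks (245 + 1) tab :=
    h245.extend fun n hn hnk ↦ idxValid_of_checkTable (prm := prm) (by norm_num [prm]) a_pos consts_valid tT245 hn hnk
  have h247 : TabValid (2 ^ 320) a ks (246 + 1) tab :=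
    h246.extend fun n hn hnk ↦ idxValid_of_checkTable (prm := prm) (by norm_num [prm]) a_pos consts_valid tT246 hn hnk
  have h248 : TabValid (2 ^ 320) a ks (247 + 1) tab :=
    h247.extend fun n hn hnk ↦ idxValid_of_checkTable (prm := prm) (by norm_num [prm]) a_pos consts_valid tT247 hn hnk
  have h249 : TabValid (2 ^ 320) a ks (248 + 1) tab :=
    h248.extend fun n hn hnk ↦ idxValid_of_checkTable (prm := prm) (by norm_num [prm]) a_pos consts_valid tT248 hn hnk
  have h250 : TabValid (2 ^ 320) a ks (249 + 1) tab :=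
    h249.extend fun n hn hnk ↦ idxValid_of_checkTable (prm := prm) (by norm_num [prm]) a_pos consts_valid tT249 hn hnk
  exact h250

-- (merged) from WeilFormatCDataO109TabValid18

/-- the special-value table is valid below `265` (partial). -/
theorem tabv265 : TabValid (2 ^ 320) O109.a O109.ks 265 O109.tab := by
  have h250 : TabValid (2 ^ 320) a ks 250 tab := tabv250
  have h251 : TabValid (2 ^ 320) a ks (250 + 1) tab :=
    h250.extend fun n hn hnk ↦ idxValid_of_checkTable (prm := prm) (by norm_num [prm]) a_pos consts_valid tT250 hn hnk
  have h252 : TabValid (2 ^ 320) a ks (251 + 1) tab :=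
    h251.extend fun n hn hnk ↦ idxValid_of_checkTable (prm := prm) (by norm_num [prm]) a_pos consts_valid tT251 hn hnk
  have h253 : TabValid (2 ^ 320) a ks (252 + 1) tab :=
    h252.extend fun n hn hnk ↦ idxValid_of_checkTable (prm := prm) (by norm_num [prm]) a_pos consts_valid tT252 hn hnk
  have h254 : TabValid (2 ^ 320) a ks (253 + 1) tab :=
    h253.extend fun n hn hnk ↦ idxValid_of_checkTable (prm := prm) (by norm_num [prm]) a_pos consts_valid tT253 hn hnk
  have h255 : TabValid (2 ^ 320) a ks (254 + 1) tab :=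
    h254.extend fun n hn hnk ↦ idxValid_of_checkTable (prm := prm) (by norm_num [prm]) a_pos consts_valid tT254 hn hnk
  have h256 : TabValid (2 ^ 320) a ks (255 + 1) tab :=
    h255.extend fun n hn hnk ↦ idxValid_of_checkTable (prm := prm) (by norm_num [prm]) a_pos consts_valid tT255 hn hnk
  have h257 : TabValid (2 ^ 320) a ks (256 + 1) tab :=
    h256.extend fun n hn hnk ↦ idxValid_of_checkTable (prm := prm) (by norm_num [prm]) a_pos consts_valid tT256 hn hnk
  have h258 : TabValid (2 ^ 320) a ks (257 + 1) tab :=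
    h257.extend fun n hn hnk ↦ idxValid_of_checkTable (prm := prm) (by norm_num [prm]) a_pos consts_valid tT257 hn hnk
  have h259 : TabValid (2 ^ 320) a ks (258 + 1) tab :=
    h258.extend fun n hn hnk ↦ idxValid_of_checkTable (prm := prm) (by norm_num [prm]) a_pos consts_valid tT258 hn hnk
  have h260 : TabValid (2 ^ 320) a ks (259 + 1) tab :=
    h259.extend fun n hn hnk ↦ idxValid_of_checkTable (prm := prm) (by norm_num [prm]) a_pos consts_valid tT259 hn hnk
  have h261 : TabValid (2 ^ 320) a ks (260 + 1) tab :=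
    h260.extend fun n hn hnk ↦ idxValid_of_checkTable (prm := prm) (by norm_num [prm]) a_pos consts_valid tT260 hn hnk
  have h262 : TabValid (2 ^ 320) a ks (261 + 1) tab :=
    h261.extend fun n hn hnk ↦ idxValid_of_checkTable (prm := prm) (by norm_num [prm]) a_pos consts_valid tT261 hn hnk
  have h263 : TabValid (2 ^ 320) a ks (262 + 1) tab :=
    h262.extend fun n hn hnk ↦ idxValid_of_checkTable (prm := prm) (by norm_num [prm]) a_pos consts_valid tT262 hn hnk
  have h264 : TabValid (2 ^ 320) a ks (263 + 1) tab :=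
    h263.extend fun n hn hnk ↦ idxValid_of_checkTable (prm := prm) (by norm_num [prm]) a_pos consts_valid tT263 hn hnk
  have h265 : TabValid (2 ^ 320) a ks (264 + 1) tab :=
    h264.extend fun n hn hnk ↦ idxValid_of_checkTable (prm := prm) (by norm_num [prm]) a_pos consts_valid tT264 hn hnk
  exact h265

-- (merged) from WeilFormatCDataO109TabValid19

/-- the special-value table is valid below `280` (partial). -/
theorem tabv280 : TabValid (2 ^ 320) O109.a O109.ks 280 O109.tab := by
  have h265 : TabValid (2 ^ 320) a ks 265 tab := tabv265
  have h266 : TabValid (2 ^ 320) a ks (265 + 1) tab :=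
    h265.extend fun n hn hnk ↦ idxValid_of_checkTable (prm := prm) (by norm_num [prm]) a_pos consts_valid tT265 hn hnk
  have h267 : TabValid (2 ^ 320) a ks (266 + 1) tab :=
    h266.extend fun n hn hnk ↦ idxValid_of_checkTable (prm := prm) (by norm_num [prm]) a_pos consts_valid tT266 hn hnk
  have h268 : TabValid (2 ^ 320) a ks (267 + 1) tab :=
    h267.extend fun n hn hnk ↦ idxValid_of_checkTable (prm := prm) (by norm_num [prm]) a_pos consts_valid tT267 hn hnk
  have h269 : TabValid (2 ^ 320) a ks (268 + 1) tab :=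
    h268.extend fun n hn hnk ↦ idxValid_of_checkTable (prm := prm) (by norm_num [prm]) a_pos consts_valid tT268 hn hnk
  have h270 : TabValid (2 ^ 320) a ks (269 + 1) tab :=
    h269.extend fun n hn hnk ↦ idxValid_of_checkTable (prm := prm) (by norm_num [prm]) a_pos consts_valid tT269 hn hnk
  have h271 : TabValid (2 ^ 320) a ks (270 + 1) tab :=
    h270.extend fun n hn hnk ↦ idxValid_of_checkTable (prm := prm) (by norm_num [prm]) a_pos consts_valid tT270 hn hnk
  have h272 : TabValid (2 ^ 320) a ks (271 + 1) tab :=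
    h271.extend fun n hn hnk ↦ idxValid_of_checkTable (prm := prm) (by norm_num [prm]) a_pos consts_valid tT271 hn hnk
  have h273 : TabValid (2 ^ 320) a ks (272 + 1) tab :=
    h272.extend fun n hn hnk ↦ idxValid_of_checkTable (prm := prm) (by norm_num [prm]) a_pos consts_valid tT272 hn hnk
  have h274 : TabValid (2 ^ 320) a ks (273 + 1) tab :=
    h273.extend fun n hn hnk ↦ idxValid_of_checkTable (prm := prm) (by norm_num [prm]) a_pos consts_valid tT273 hn hnk
  have h275 : TabValid (2 ^ 320) a ks (274 + 1) tab :=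
    h274.extend fun n hn hnk ↦ idxValid_of_checkTable (prm := prm) (by norm_num [prm]) a_pos consts_valid tT274 hn hnk
  have h276 : TabValid (2 ^ 320) a ks (275 + 1) tab :=
    h275.extend fun n hn hnk ↦ idxValid_of_checkTable (prm := prm) (by norm_num [prm]) a_pos consts_valid tT275 hn hnk
  have h277 : TabValid (2 ^ 320) a ks (276 + 1) tab :=
    h276.extend fun n hn hnk ↦ idxValid_of_checkTable (prm := prm) (by norm_num [prm]) a_pos consts_valid tT276 hn hnk
  have h278 : TabValid (2 ^ 320) a ks (277 + 1) tab :=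
    h277.extend fun n hn hnk ↦ idxValid_of_checkTable (prm := prm) (by norm_num [prm]) a_pos consts_valid tT277 hn hnk
  have h279 : TabValid (2 ^ 320) a ks (278 + 1) tab :=
    h278.extend fun n hn hnk ↦ idxValid_of_checkTable (prm := prm) (by norm_num [prm]) a_pos consts_valid tT278 hn hnk
  have h280 : TabValid (2 ^ 320) a ks (279 + 1) tab :=
    h279.extend fun n hn hnk ↦ idxValid_of_checkTable (prm := prm) (by norm_num [prm]) a_pos consts_valid tT279 hn hnk
  exact h280

-- (merged) from WeilFormatCDataO109TabValid20

/-- the special-value table is valid below `295` (partial). -/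
theorem tabv295 : TabValid (2 ^ 320) O109.a O109.ks 295 O109.tab := by
  have h280 : TabValid (2 ^ 320) a ks 280 tab := tabv280
  have h281 : TabValid (2 ^ 320) a ks (280 + 1) tab :=
    h280.extend fun n hn hnk ↦ idxValid_of_checkTable (prm := prm) (by norm_num [prm]) a_pos consts_valid tT280 hn hnk
  have h282 : TabValid (2 ^ 320) a ks (281 + 1) tab :=
    h281.extend fun n hn hnk ↦ idxValid_of_checkTable (prm := prm) (by norm_num [prm]) a_pos consts_valid tT281 hn hnk
  have h283 : TabValid (2 ^ 320) a ks (282 + 1) tab :=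
    h282.extend fun n hn hnk ↦ idxValid_of_checkTable (prm := prm) (by norm_num [prm]) a_pos consts_valid tT282 hn hnk
  have h284 : TabValid (2 ^ 320) a ks (283 + 1) tab :=
    h283.extend fun n hn hnk ↦ idxValid_of_checkTable (prm := prm) (by norm_num [prm]) a_pos consts_valid tT283 hn hnk
  have h285 : TabValid (2 ^ 320) a ks (284 + 1) tab :=
    h284.extend fun n hn hnk ↦ idxValid_of_checkTable (prm := prm) (by norm_num [prm]) a_pos consts_valid tT284 hn hnk
  have h286 : TabValid (2 ^ 320) a ks (285 + 1) tab :=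
    h285.extend fun n hn hnk ↦ idxValid_of_checkTable (prm := prm) (by norm_num [prm]) a_pos consts_valid tT285 hn hnk
  have h287 : TabValid (2 ^ 320) a ks (286 + 1) tab :=
    h286.extend fun n hn hnk ↦ idxValid_of_checkTable (prm := prm) (by norm_num [prm]) a_pos consts_valid tT286 hn hnk
  have h288 : TabValid (2 ^ 320) a ks (287 + 1) tab :=
    h287.extend fun n hn hnk ↦ idxValid_of_checkTable (prm := prm) (by norm_num [prm]) a_pos consts_valid tT287 hn hnk
  have h289 : TabValid (2 ^ 320) a ks (288 + 1) tab :=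
    h288.extend fun n hn hnk ↦ idxValid_of_checkTable (prm := prm) (by norm_num [prm]) a_pos consts_valid tT288 hn hnk
  have h290 : TabValid (2 ^ 320) a ks (289 + 1) tab :=
    h289.extend fun n hn hnk ↦ idxValid_of_checkTable (prm := prm) (by norm_num [prm]) a_pos consts_valid tT289 hn hnk
  have h291 : TabValid (2 ^ 320) a ks (290 + 1) tab :=
    h290.extend fun n hn hnk ↦ idxValid_of_checkTable (prm := prm) (by norm_num [prm]) a_pos consts_valid tT290 hn hnk
  have h292 : TabValid (2 ^ 320) a ks (291 + 1) tab :=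
    h291.extend fun n hn hnk ↦ idxValid_of_checkTable (prm := prm) (by norm_num [prm]) a_pos consts_valid tT291 hn hnk
  have h293 : TabValid (2 ^ 320) a ks (292 + 1) tab :=
    h292.extend fun n hn hnk ↦ idxValid_of_checkTable (prm := prm) (by norm_num [prm]) a_pos consts_valid tT292 hn hnk
  have h294 : TabValid (2 ^ 320) a ks (293 + 1) tab :=
    h293.extend fun n hn hnk ↦ idxValid_of_checkTable (prm := prm) (by norm_num [prm]) a_pos consts_valid tT293 hn hnk
  have h295 : TabValid (2 ^ 320) a ks (294 + 1) tab :=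
    h294.extend fun n hn hnk ↦ idxValid_of_checkTable (prm := prm) (by norm_num [prm]) a_pos consts_valid tT294 hn hnk
  exact h295

-- (merged) from WeilFormatCDataO109TabValid21

/-- the special-value table is valid below `310` (partial). -/
theorem tabv310 : TabValid (2 ^ 320) O109.a O109.ks 310 O109.tab := by
  have h295 : TabValid (2 ^ 320) a ks 295 tab := tabv295
  have h296 : TabValid (2 ^ 320) a ks (295 + 1) tab :=
    h295.extend fun n hn hnk ↦ idxValid_of_checkTable (prm := prm) (by norm_num [prm]) a_pos consts_valid tT295 hn hnk
  have h297 : TabValid (2 ^ 320) a ks (296 + 1) tab :=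
    h296.extend fun n hn hnk ↦ idxValid_of_checkTable (prm := prm) (by norm_num [prm]) a_pos consts_valid tT296 hn hnk
  have h298 : TabValid (2 ^ 320) a ks (297 + 1) tab :=
    h297.extend fun n hn hnk ↦ idxValid_of_checkTable (prm := prm) (by norm_num [prm]) a_pos consts_valid tT297 hn hnk
  have h299 : TabValid (2 ^ 320) a ks (298 + 1) tab :=
    h298.extend fun n hn hnk ↦ idxValid_of_checkTable (prm := prm) (by norm_num [prm]) a_pos consts_valid tT298 hn hnk
  have h300 : TabValid (2 ^ 320) a ks (299 + 1) tab :=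
    h299.extend fun n hn hnk ↦ idxValid_of_checkTable (prm := prm) (by norm_num [prm]) a_pos consts_valid tT299 hn hnk
  have h301 : TabValid (2 ^ 320) a ks (300 + 1) tab :=
    h300.extend fun n hn hnk ↦ idxValid_of_checkTable (prm := prm) (by norm_num [prm]) a_pos consts_valid tT300 hn hnk
  have h302 : TabValid (2 ^ 320) a ks (301 + 1) tab :=
    h301.extend fun n hn hnk ↦ idxValid_of_checkTable (prm := prm) (by norm_num [prm]) a_pos consts_valid tT301 hn hnk
  have h303 : TabValid (2 ^ 320) a ks (302 + 1) tab :=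
    h302.extend fun n hn hnk ↦ idxValid_of_checkTable (prm := prm) (by norm_num [prm]) a_pos consts_valid tT302 hn hnk
  have h304 : TabValid (2 ^ 320) a ks (303 + 1) tab :=
    h303.extend fun n hn hnk ↦ idxValid_of_checkTable (prm := prm) (by norm_num [prm]) a_pos consts_valid tT303 hn hnk
  have h305 : TabValid (2 ^ 320) a ks (304 + 1) tab :=
    h304.extend fun n hn hnk ↦ idxValid_of_checkTable (prm := prm) (by norm_num [prm]) a_pos consts_valid tT304 hn hnk
  have h306 : TabValid (2 ^ 320) a ks (305 + 1) tab :=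
    h305.extend fun n hn hnk ↦ idxValid_of_checkTable (prm := prm) (by norm_num [prm]) a_pos consts_valid tT305 hn hnk
  have h307 : TabValid (2 ^ 320) a ks (306 + 1) tab :=
    h306.extend fun n hn hnk ↦ idxValid_of_checkTable (prm := prm) (by norm_num [prm]) a_pos consts_valid tT306 hn hnk
  have h308 : TabValid (2 ^ 320) a ks (307 + 1) tab :=
    h307.extend fun n hn hnk ↦ idxValid_of_checkTable (prm := prm) (by norm_num [prm]) a_pos consts_valid tT307 hn hnk
  have h309 : TabValid (2 ^ 320) a ks (308 + 1) tab :=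
    h308.extend fun n hn hnk ↦ idxValid_of_checkTable (prm := prm) (by norm_num [prm]) a_pos consts_valid tT308 hn hnk
  have h310 : TabValid (2 ^ 320) a ks (309 + 1) tab :=
    h309.extend fun n hn hnk ↦ idxValid_of_checkTable (prm := prm) (by norm_num [prm]) a_pos consts_valid tT309 hn hnk
  exact h310

-- (merged) from WeilFormatCDataO109TabValid

/-- the special-value table is valid below `321`. -/
theorem tab_valid : TabValid (2 ^ 320) O109.a O109.ks 321 O109.tab := by
  have h310 : TabValid (2 ^ 320) a ks 310 tab := tabv310
  have h311 : TabValid (2 ^ 320) a ks (310 + 1) tab :=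
    h310.extend fun n hn hnk ↦ idxValid_of_checkTable (prm := prm) (by norm_num [prm]) a_pos consts_valid tT310 hn hnk
  have h312 : TabValid (2 ^ 320) a ks (311 + 1) tab :=
    h311.extend fun n hn hnk ↦ idxValid_of_checkTable (prm := prm) (by norm_num [prm]) a_pos consts_valid tT311 hn hnk
  have h313 : TabValid (2 ^ 320) a ks (312 + 1) tab :=
    h312.extend fun n hn hnk ↦ idxValid_of_checkTable (prm := prm) (by norm_num [prm]) a_pos consts_valid tT312 hn hnk
  have h314 : TabValid (2 ^ 320) a ks (313 + 1) tab :=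
    h313.extend fun n hn hnk ↦ idxValid_of_checkTable (prm := prm) (by norm_num [prm]) a_pos consts_valid tT313 hn hnk
  have h315 : TabValid (2 ^ 320) a ks (314 + 1) tab :=
    h314.extend fun n hn hnk ↦ idxValid_of_checkTable (prm := prm) (by norm_num [prm]) a_pos consts_valid tT314 hn hnk
  have h316 : TabValid (2 ^ 320) a ks (315 + 1) tab :=
    h315.extend fun n hn hnk ↦ idxValid_of_checkTable (prm := prm) (by norm_num [prm]) a_pos consts_valid tT315 hn hnk
  have h317 : TabValid (2 ^ 320) a ks (316 + 1) tab :=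
    h316.extend fun n hn hnk ↦ idxValid_of_checkTable (prm := prm) (by norm_num [prm]) a_pos consts_valid tT316 hn hnk
  have h318 : TabValid (2 ^ 320) a ks (317 + 1) tab :=
    h317.extend fun n hn hnk ↦ idxValid_of_checkTable (prm := prm) (by norm_num [prm]) a_pos consts_valid tT317 hn hnk
  have h319 : TabValid (2 ^ 320) a ks (318 + 1) tab :=
    h318.extend fun n hn hnk ↦ idxValid_of_checkTable (prm := prm) (by norm_num [prm]) a_pos consts_valid tT318 hn hnk
  have h320 : TabValid (2 ^ 320) a ks (319 + 1) tab :=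
    h319.extend fun n hn hnk ↦ idxValid_of_checkTable (prm := prm) (by norm_num [prm]) a_pos consts_valid tT319 hn hnk
  have h321 : TabValid (2 ^ 320) a ks (320 + 1) tab :=
    h320.extend fun n hn hnk ↦ idxValid_of_checkTable (prm := prm) (by norm_num [prm]) a_pos consts_valid tT320 hn hnk
  exact h321

/-- full table for the odd rows. -/
theorem tab_valid_odd : TabValid (2 ^ 320) O109.a O109.ks (320 + 1) O109.tab := fun n hn ↦ tab_valid n (by omega)

-- (merged) from WeilFormatCDataO109ColSlice28

end Summit.RiemannHypothesis.RiemannHypothesis.Theorems.WeilFormatCData.O109
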